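import Literature.NumberTheory.Transcendental.KZCalculusProofs
import Literature.NumberTheory.Transcendental.SemialgebraicMapsProofs
import Literature.NumberTheory.Transcendental.KZMonomialCompression
import Literature.NumberTheory.Transcendental.KZProductIdeal
import Literature.NumberTheory.Transcendental.KZSemialgebraicComplex

/-!
# Crux `VolumeFormOffPlane` (stmt-KontsevichZagierPeriods-14935) — line `Sketch`,
stub `stub_logBoxLinear` (the two LINEAR moves between log-boxes)

Write `B(a, b) = {p : ℝⁿ⁺¹ | a_j < x_j < b_j, 0 < z, z · ∏ x_j < 1}` (`x_j = p (castSucc j)`,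
`z = p (last n)`) for the log-box with corners `a, b : Fin n → ℝ`. For integrand-`1`
representations `r`, `r'`:

* **scaling**: if `r.domain = B(a, b)` and `r'.domain = B(l a, l b)` with `l_j > 0` real algebraic,
  then `[r] − [r'] ∈ KZ.relations` — ONE instance of rule (2) with the diagonal linear map
  `diag(l_1, …, l_n, (∏ l_j)⁻¹)` (determinant `1`, algebraic entries, carries `B(a, b)` onto
  `B(l a, l b)` because the slack is rescaled by `(∏ l_j)⁻¹`);
* **permutation**: if `r.domain = B(a, b)` and `r'.domain = B(a ∘ σ, b ∘ σ)` for a permutation `σ`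
  of the box coordinates, then `[r] − [r'] ∈ KZ.relations` — the coordinate relabelling
  `KZ.IntegralRep.reindex` along the permutation of `Fin (n + 1)` extending `σ⁻¹` and fixing the
  slack coordinate (a rule-(2) move, `KZ.of_sub_of_reindex_mem_relations`), followed by the
  identity move between two representations with the same domain and integrand `1` on it.

Sources: M. Kontsevich, D. Zagier, *Periods* (2001), §1.2 rule (2). The bookkeeping is folklore;
the diagonal move is adapted from `KZ.exists_isBounded_of_downset`
(`Literature/NumberTheory/Transcendental/KZMonomialCompression.lean`).
-/

noncomputable section

open MeasureTheory Set MvPolynomial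
open Literature.NumberTheory.Transcendental Literature.ModelTheory.ExponentialFields

namespace Summit.KontsevichZagierPeriods.SymplecticScissors.LogPolytope

/-! ## Diagonal linear maps -/

/-- The diagonal map in coordinates: `diag(c) x = (c_i x_i)_i`. [folklore] -/
theorem lbl_diag_apply {N : ℕ} (c : Fin N → ℝ) (x : Fin N → ℝ) (i : Fin N) :
    (LinearMap.toContinuousLinearMap (Matrix.toLin' (Matrix.diagonal c)) :
      (Fin N → ℝ) →L[ℝ] (Fin N → ℝ)) x i = c i * x i := by
  rw [LinearMap.coe_toContinuousLinearMap', Matrix.toLin'_apply, Matrix.mulVec_diagonal]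

/-- `det diag(c) = ∏ c_i`. [folklore] -/
theorem lbl_det_diag {N : ℕ} (c : Fin N → ℝ) :
    (LinearMap.toContinuousLinearMap (Matrix.toLin' (Matrix.diagonal c)) :
      (Fin N → ℝ) →L[ℝ] (Fin N → ℝ)).det = ∏ i, c i := by
  -- adapted from `KZ.exists_isBounded_of_downset` (the linear rescaling step)
  rw [ContinuousLinearMap.det]
  simp only [LinearMap.coe_toContinuousLinearMap]
  rw [LinearMap.det_toLin', Matrix.det_diagonal]

/-- A diagonal map with real-algebraic entries is a `ℚ`-semialgebraic map on every
`ℚ`-semialgebraic set (coordinatewise: an algebraic constant times a coordinate). [folklore] -/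
theorem lbl_isSemialgebraicMapOn_diag {N : ℕ} {c : Fin N → ℝ} (hc : ∀ i, IsAlgebraic ℚ (c i))
    {s : Set (Fin N → ℝ)} (hs : IsSemialgebraic ℚ s) :
    IsSemialgebraicMapOn ℚ s
      (LinearMap.toContinuousLinearMap (Matrix.toLin' (Matrix.diagonal c)) :
        (Fin N → ℝ) →L[ℝ] (Fin N → ℝ)) := by
  refine IsSemialgebraicMapOn.of_forall hs fun i => ?_
  have h := IsSemialgebraicFunOn.mul_holds (isSemialgebraicFunOn_const_of_isAlgebraic hs (hc i))
    (isSemialgebraicFunOn_aeval hs (X i : MvPolynomial (Fin N) ℚ))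
  exact h.congr fun q _ => by simp [lbl_diag_apply]

/-- A diagonal map with non-zero entries is injective. [folklore] -/
theorem lbl_injective_diag {N : ℕ} {c : Fin N → ℝ} (hc : ∀ i, c i ≠ 0) :
    Function.Injective
      (LinearMap.toContinuousLinearMap (Matrix.toLin' (Matrix.diagonal c)) :
        (Fin N → ℝ) →L[ℝ] (Fin N → ℝ)) := by
  intro x y hxy
  funext i
  have h := congr_fun hxy i
  rw [lbl_diag_apply, lbl_diag_apply] at h
  exact mul_left_cancel₀ (hc i) h

/-- The image of a set under a diagonal map with non-zero entries is its preimage under the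
inverse diagonal map. [folklore] -/
theorem lbl_image_diag {N : ℕ} {c : Fin N → ℝ} (hc : ∀ i, c i ≠ 0) (s : Set (Fin N → ℝ)) :
    (LinearMap.toContinuousLinearMap (Matrix.toLin' (Matrix.diagonal c)) :
      (Fin N → ℝ) →L[ℝ] (Fin N → ℝ)) '' s = {q | (fun i => (c i)⁻¹ * q i) ∈ s} := by
  ext q
  simp only [mem_image, mem_setOf_eq]
  constructor
  · rintro ⟨p, hp, rfl⟩
    convert hp using 1
    funext i
    rw [lbl_diag_apply, inv_mul_cancel_left₀ (hc i)]
  · intro hq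
    refine ⟨_, hq, ?_⟩
    funext i
    rw [lbl_diag_apply, mul_inv_cancel_left₀ (hc i)]

/-- A finite product of real-algebraic numbers is algebraic. [folklore] -/
theorem lbl_isAlgebraic_prod {n : ℕ} {l : Fin n → ℝ} (hl : ∀ j, IsAlgebraic ℚ (l j)) :
    IsAlgebraic ℚ (∏ j, l j) :=
  (Subalgebra.mem_algebraicClosure (R := ℚ) (S := ℝ)).mp
    (prod_mem fun j _ => (Subalgebra.mem_algebraicClosure (R := ℚ) (S := ℝ)).mpr (hl j))

/-! ## The scaling move -/

/-- **Scaling of a log-box is one rule-(2) move.** For `l_j > 0` real algebraic, the diagonal map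
`diag(l, (∏ l_j)⁻¹)` (determinant `1`) carries the integrand-`1` representation on `B(a, b)` to
the one on `B(l a, l b)`: `[r] − [r'] ∈ KZ.relations`. [folklore] -/
theorem lbl_scaling : ∀ (n : ℕ) (a b l : Fin n → ℝ), (∀ j, 0 < l j) → (∀ j, IsAlgebraic ℚ (l j)) →
    ∀ (r r' : KZ.IntegralRep (n + 1)),
    r.domain = {p : Fin (n + 1) → ℝ | (∀ j : Fin n, a j < p (Fin.castSucc j) ∧
      p (Fin.castSucc j) < b j) ∧ 0 < p (Fin.last n) ∧
      p (Fin.last n) * ∏ j : Fin n, p (Fin.castSucc j) < 1} →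
    r'.domain = {p : Fin (n + 1) → ℝ | (∀ j : Fin n, l j * a j < p (Fin.castSucc j) ∧
      p (Fin.castSucc j) < l j * b j) ∧ 0 < p (Fin.last n) ∧
      p (Fin.last n) * ∏ j : Fin n, p (Fin.castSucc j) < 1} →
    (∀ p ∈ r.domain, r.integrand p = 1) → (∀ p ∈ r'.domain, r'.integrand p = 1) →
    KZ.of r - KZ.of r' ∈ KZ.relations := by
  intro n a b l hl halg r r' hr hr' hri hri'
  -- the product of the scaling factors
  obtain ⟨P, hP⟩ : ∃ P : ℝ, P = ∏ j, l j := ⟨_, rfl⟩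
  have hP0 : 0 < P := hP ▸ Finset.prod_pos fun j _ => hl j
  have hPalg : IsAlgebraic ℚ P := hP ▸ lbl_isAlgebraic_prod halg
  -- the diagonal entries `c = (l, P⁻¹)`
  obtain ⟨c, hc⟩ : ∃ c : Fin (n + 1) → ℝ, c = Fin.snoc l P⁻¹ := ⟨_, rfl⟩
  have hcs : ∀ j : Fin n, c (Fin.castSucc j) = l j := fun j => by simp [hc]
  have hcl : c (Fin.last n) = P⁻¹ := by simp [hc]
  have hc0 : ∀ i, c i ≠ 0 := fun i => by
    induction i using Fin.lastCases with
    | last => rw [hcl]; positivity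
    | cast j => rw [hcs]; exact (hl j).ne'
  have hcalg : ∀ i, IsAlgebraic ℚ (c i) := fun i => by
    induction i using Fin.lastCases with
    | last => rw [hcl]; exact hPalg.inv
    | cast j => rw [hcs]; exact halg j
  have hdet : (LinearMap.toContinuousLinearMap (Matrix.toLin' (Matrix.diagonal c)) :
      (Fin (n + 1) → ℝ) →L[ℝ] (Fin (n + 1) → ℝ)).det = 1 := by
    rw [lbl_det_diag, Fin.prod_univ_castSucc]
    simp only [hcs, hcl]
    rw [← hP, mul_inv_cancel₀ hP0.ne']
  -- the image of the log-box
  have hd : r'.domain = (LinearMap.toContinuousLinearMap (Matrix.toLin' (Matrix.diagonal c)) :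
      (Fin (n + 1) → ℝ) →L[ℝ] (Fin (n + 1) → ℝ)) '' r.domain := by
    rw [hr, hr', lbl_image_diag hc0]
    ext q
    simp only [mem_setOf_eq, hcs, hcl, inv_inv]
    have key : P * q (Fin.last n) * ∏ j : Fin n, (l j)⁻¹ * q (Fin.castSucc j) =
        q (Fin.last n) * ∏ j : Fin n, q (Fin.castSucc j) := by
      rw [Finset.prod_mul_distrib, Finset.prod_inv_distrib, ← hP]
      field_simp
    rw [key, mul_pos_iff_of_pos_left hP0]
    refine and_congr_left fun _ => forall_congr' fun j => ?_
    rw [lt_inv_mul_iff₀ (hl j), inv_mul_lt_iff₀ (hl j)]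
  refine KZ.changeOfVariablesRel_subset_relations
    (KZ.of_sub_of_mem_changeOfVariablesRel_linear r r' _
      (lbl_isSemialgebraicMapOn_diag hcalg r.isSemialgebraic_domain)
      (lbl_injective_diag hc0).injOn hd fun x hx => ?_)
  rw [hri x hx, hri' _ (hd ▸ mem_image_of_mem _ hx), hdet, abs_one, mul_one]

/-! ## The permutation move -/

/-- **Permuting the box coordinates of a log-box is a relation.** For a permutation `σ` of
`Fin n`, the integrand-`1` representations on `B(a, b)` and on `B(a ∘ σ, b ∘ σ)` satisfy
`[r] − [r'] ∈ KZ.relations`: reindex `r` along the permutation of `Fin (n + 1)` extending `σ⁻¹`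
and fixing the slack coordinate (rule (2), `|det| = 1`), then compare two representations with the
same domain and integrand `1` on it. [folklore] -/
theorem lbl_perm : ∀ (n : ℕ) (a b : Fin n → ℝ) (σ : Equiv.Perm (Fin n)),
    ∀ (r r' : KZ.IntegralRep (n + 1)),
    r.domain = {p : Fin (n + 1) → ℝ | (∀ j : Fin n, a j < p (Fin.castSucc j) ∧
      p (Fin.castSucc j) < b j) ∧ 0 < p (Fin.last n) ∧
      p (Fin.last n) * ∏ j : Fin n, p (Fin.castSucc j) < 1} →
    r'.domain = {p : Fin (n + 1) → ℝ | (∀ j : Fin n, a (σ j) < p (Fin.castSucc j) ∧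
      p (Fin.castSucc j) < b (σ j)) ∧ 0 < p (Fin.last n) ∧
      p (Fin.last n) * ∏ j : Fin n, p (Fin.castSucc j) < 1} →
    (∀ p ∈ r.domain, r.integrand p = 1) → (∀ p ∈ r'.domain, r'.integrand p = 1) →
    KZ.of r - KZ.of r' ∈ KZ.relations := by
  intro n a b σ r r' hr hr' hri hri'
  -- the permutation of `Fin (n + 1)` extending `σ⁻¹` and fixing the last coordinate
  obtain ⟨e, he⟩ : ∃ e : Equiv.Perm (Fin (n + 1)),
      e = finSuccEquivLast.trans ((Equiv.optionCongr σ.symm).trans finSuccEquivLast.symm) :=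
    ⟨_, rfl⟩
  have hes : ∀ j : Fin n, e (Fin.castSucc j) = Fin.castSucc (σ.symm j) := fun j => by
    simp only [he, Equiv.trans_apply, finSuccEquivLast_castSucc, Equiv.optionCongr_apply,
      Option.map_some, finSuccEquivLast_symm_some]
  have hel : e (Fin.last n) = Fin.last n := by
    simp only [he, Equiv.trans_apply, finSuccEquivLast_last, Equiv.optionCongr_apply,
      Option.map_none, finSuccEquivLast_symm_none]
  have hd : r'.domain = (r.reindex e).domain := by
    rw [KZ.IntegralRep.reindex_domain, hr, hr']
    ext w
    simp only [mem_setOf_eq, hes, hel]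
    rw [Equiv.prod_comp σ.symm (fun j => w (Fin.castSucc j))]
    refine and_congr_left fun _ => ⟨fun h j => ?_, fun h j => ?_⟩
    · simpa using h (σ.symm j)
    · simpa using h (σ j)
  have h1 : KZ.of r - KZ.of (r.reindex e) ∈ KZ.relations := KZ.of_sub_of_reindex_mem_relations r e
  have h2 : KZ.of (r.reindex e) - KZ.of r' ∈ KZ.relations := by
    refine KZ.of_sub_of_mem_relations_of_eqOn hd fun w hw => ?_
    rw [KZ.IntegralRep.reindex_integrand]
    exact (hri _ hw).trans (hri' w (hd ▸ hw)).symm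
  have : KZ.of r - KZ.of r' =
      (KZ.of r - KZ.of (r.reindex e)) + (KZ.of (r.reindex e) - KZ.of r') := by abel
  rw [this]
  exact KZ.relations.add_mem h1 h2

/-! ## The stub -/

/-- **Stub (the two linear moves between log-boxes).** (i) Scaling the box coordinates of a
log-box by positive real-algebraic factors `l_j` (and the slack by `(∏ l_j)⁻¹`) is one rule-(2)
move of determinant `1`; (ii) permuting the box coordinates is one rule-(2) move (a coordinate
permutation, `|det| = 1`). In both cases `[r] − [r'] ∈ KZ.relations` for the integrand-`1`
representations on the two log-boxes. [folklore] -/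
theorem stub_logBoxLinear :
    (∀ (n : ℕ) (a b l : Fin n → ℝ), (∀ j, 0 < l j) → (∀ j, IsAlgebraic ℚ (l j)) →
      ∀ (r r' : KZ.IntegralRep (n + 1)),
      r.domain = {p : Fin (n + 1) → ℝ | (∀ j : Fin n, a j < p (Fin.castSucc j) ∧
        p (Fin.castSucc j) < b j) ∧ 0 < p (Fin.last n) ∧
        p (Fin.last n) * ∏ j : Fin n, p (Fin.castSucc j) < 1} →
      r'.domain = {p : Fin (n + 1) → ℝ | (∀ j : Fin n, l j * a j < p (Fin.castSucc j) ∧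
        p (Fin.castSucc j) < l j * b j) ∧ 0 < p (Fin.last n) ∧
        p (Fin.last n) * ∏ j : Fin n, p (Fin.castSucc j) < 1} →
      (∀ p ∈ r.domain, r.integrand p = 1) → (∀ p ∈ r'.domain, r'.integrand p = 1) →
      KZ.of r - KZ.of r' ∈ KZ.relations) ∧
    (∀ (n : ℕ) (a b : Fin n → ℝ) (σ : Equiv.Perm (Fin n)),
      ∀ (r r' : KZ.IntegralRep (n + 1)),
      r.domain = {p : Fin (n + 1) → ℝ | (∀ j : Fin n, a j < p (Fin.castSucc j) ∧
        p (Fin.castSucc j) < b j) ∧ 0 < p (Fin.last n) ∧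
        p (Fin.last n) * ∏ j : Fin n, p (Fin.castSucc j) < 1} →
      r'.domain = {p : Fin (n + 1) → ℝ | (∀ j : Fin n, a (σ j) < p (Fin.castSucc j) ∧
        p (Fin.castSucc j) < b (σ j)) ∧ 0 < p (Fin.last n) ∧
        p (Fin.last n) * ∏ j : Fin n, p (Fin.castSucc j) < 1} →
      (∀ p ∈ r.domain, r.integrand p = 1) → (∀ p ∈ r'.domain, r'.integrand p = 1) →
      KZ.of r - KZ.of r' ∈ KZ.relations) :=
  ⟨lbl_scaling, lbl_perm⟩

end Summit.KontsevichZagierPeriods.SymplecticScissors.LogPolytope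

end
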